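import Summits.CriticalPhenomena.SAWScalingLimit.Theorems.SAWDefectDecoherenceBoundaryClosureRPickEngineWeakDbar
import Summits.CriticalPhenomena.SAWScalingLimit.Theorems.SAWDefectDecoherenceBoundaryClosureRLocalL1WeakStar
import Literature.Analysis.Complex.WeylLemmaDbarFunctional
import HarnessLib

/-!
# Holomorphic local representation of the weak limit: engine inputs (S1)+(S2) composed
(crux `BoundaryClosureR`, stmt-CriticalPhenomena-14004, line `pick-half-plane`, stub `stub_pickEngine`;
registered sub-goal `pickEngine_holomorphicWeakLimit`)

Inputs, all landed: the weak-* subsequential limit `L` of the normalised bulk functionals from the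
local `L¹` law (`PickHalfPlane.LocalL1.weakStarLimit_of_localL1`, p93817: convergence on all
continuous compactly supported tests, linearity, `C_K` sup-norm bounds, representing functionals
`Λb` on `ℂ →ᵇ ℂ` per compact), w-engine's weak `∂̄`-closure (`…PickEngineWeakDbar`: DCS Lemma 1
summed by parts + `ConjugateClassNegligible`), here re-proved in FUNCTIONAL form
(`weakDbar_functional`: the limit values `l ψ` need not be represented by a function), and Weyl's
lemma for functionals (`Literature.Analysis.Complex.weyl_dbar_ball_functional`, p91905).

OUTPUT (`holomorphicWeakLimit_ball`, registered as `pickEngine_holomorphicWeakLimit`): under the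
skeleton binders (`AdmissibleFamily`, `PinnedFlatRoot` unfolded, `x ≠ D.pt 1`),
`ConjugateClassNegligible` and the local `L¹` law, every mesh sequence has a subsequence `ns ∘ ms`
and a limit `L` with: `N_{ns (ms n)}(ψ) → L ψ` for all continuous compactly supported `ψ` in the
carrier; `L` linear and `C_K`-bounded; `L(∂̄φ) = 0` for smooth compactly supported `φ`; and for every
ball with `closedBall z₀ (3R) ⊆ carrier` a function `g` HOLOMORPHIC on `ball z₀ (3R/2)` with
`L φ = ∫ φ g` for all smooth `φ` supported in `ball z₀ R`.

Deliberately NOT here (the remaining steps to the (S1) slot of `pickEngine_stage1`): extension of the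
ball representation from smooth to continuous tests (mollification + the `C_K` bound), and patching of
the local `g`'s to one holomorphic `g` on the carrier (uniqueness on overlaps by
`IsOpen.ae_eq_zero_of_integral_contDiff_smul_eq_zero` + a partition of unity on `tsupport ψ`).
-/

noncomputable section

open scoped Topology ComplexConjugate ContDiff BoundedContinuousFunction Classical
open Filter Set Metric Complex MeasureTheory
open Literature.Probability.LatticeModels Literature.Probability.RandomPlanarGeometry
open Literature.Probability.RandomPlanarGeometry.SAW
open Literature.Barriers.CriticalPhenomena Literature.Barriers.CriticalPhenomena.HexGreen
open Literature.Barriers.CriticalPhenomena.HexKernel (vecA term)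
open Literature.Analysis.Complex (dbarAlong dbarAlong_one dbarAlong_eq_zero_of_notMem_tsupport
  weyl_dbar_ball_functional)
open Summit.CriticalPhenomena.SAWScalingLimit.Theses.SAWDefectDecoherence
open Summit.CriticalPhenomena.SAWScalingLimit.Theorems.PickHalfPlane.Engine

namespace Summit.CriticalPhenomena.SAWScalingLimit.Theorems.PickHalfPlane.LocalL1

/-- **The weak `∂̄`-closure of the limit, FUNCTIONAL form** (the proof of w-engine's
`pickEngine_weakDbar` with the represented limit `∫ ψ g₀` replaced by an arbitrary limit value
`l ψ`): for an admissible family pinned at a flat root `x ≠ D.pt 1`, the route's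
`ConjugateClassNegligible`, the local `L¹` law at the root family, and ANY assignment `l` of limits
to the normalised functionals along a mesh sequence (`N_{ns n}(ψ) → l ψ` for continuous compactly
supported `ψ` in the carrier): `l(∂̄φ) = 0` for every smooth `φ` compactly supported in the carrier.
Mechanism verbatim from `…PickEngineWeakDbar` (DCS Lemma 1 summed by parts, `pickEngine_edgeTaylor`,
`pickEngine_weakDbarBound`, `ConjugateClassNegligible` at the re-marked domain). [folklore] -/
theorem weakDbar_functional :
    ConjugateClassNegligible →
    ∀ (D : DobrushinDomain) (ρ : ℝ) (Λ : ℝ → Finset HexVertex) (m : ℝ → ℤ)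
      (b : ℝ → Sym2 HexVertex),
    (0 < ρ ∧
      D.carrier ∩ Metric.ball (D.pt 1) ρ = {z : ℂ | (D.pt 1).im < z.im} ∩ Metric.ball (D.pt 1) ρ ∧
      (∀ᶠ δ : ℝ in 𝓝[>] 0, hexDomainSimplyConnected (Λ δ) ∧ b δ ∈ hexDomainBoundary (Λ δ) ∧
        (hexGraph.induce ((Λ δ : Finset HexVertex) : Set HexVertex)).Preconnected ∧
        (∀ v ∈ Λ δ, (δ : ℂ) * hexCenter v ∈ D.carrier) ∧
        (∀ v : HexVertex, (δ : ℂ) * hexCenter v ∈ Metric.ball (D.pt 1) ρ →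
          (v ∈ Λ δ ↔ m δ ≤ v.1 1))) ∧
      (∀ K : Set ℂ, IsCompact K → K ⊆ D.carrier →
        ∀ᶠ δ : ℝ in 𝓝[>] 0, ∀ v : HexVertex, (δ : ℂ) * hexCenter v ∈ K → v ∈ Λ δ) ∧
      Tendsto (fun δ : ℝ => (δ : ℂ) * hexMidpoint (b δ)) (𝓝[>] 0) (𝓝 (D.pt 1))) →
    ∀ (x : ℂ) (e : ℝ → Sym2 HexVertex) (r : ℝ) (mr : ℝ → ℤ),
    (0 < r ∧
      D.carrier ∩ Metric.ball x r = {z : ℂ | x.im < z.im} ∩ Metric.ball x r ∧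
      (∀ᶠ δ : ℝ in 𝓝[>] 0, e δ ∈ hexDomainBoundary (Λ δ) ∧
        Nonempty (HexMidEdgeSAW (Λ δ) (e δ) (b δ)) ∧
        (∀ v : HexVertex, (δ : ℂ) * hexCenter v ∈ Metric.ball x r → (v ∈ Λ δ ↔ mr δ ≤ v.1 1))) ∧
      Tendsto (fun δ : ℝ => (δ : ℂ) * hexMidpoint (e δ)) (𝓝[>] 0) (𝓝 x)) →
    x ≠ D.pt 1 →
    (∀ K : Set ℂ, IsCompact K → K ⊆ D.carrier → ∃ C : ℝ, ∀ᶠ δ : ℝ in 𝓝[>] 0,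
      δ ^ 2 * (∑ᶠ z ∈ {z : Sym2 HexVertex | z ∈ hexDomainMidEdges (Λ δ) ∧
          (δ : ℂ) * hexMidpoint z ∈ K},
        ‖hexParafermionicObservable (Λ δ) (e δ) hexCriticalFugacity (5 / 8) z‖) ≤
      C * ‖hexParafermionicObservable (Λ δ) (e δ) hexCriticalFugacity (5 / 8) (b δ)‖) →
    ∀ (ns : ℕ → ℝ), Tendsto ns atTop (𝓝[>] 0) → ∀ (l : (ℂ → ℂ) → ℂ),
    (∀ ψ : ℂ → ℂ, Continuous ψ → HasCompactSupport ψ → tsupport ψ ⊆ D.carrier →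
      Tendsto (fun n => ((ns n : ℝ) : ℂ) ^ 2 * (∑ᶠ z ∈ hexDomainMidEdges (Λ (ns n)),
          ψ (((ns n : ℝ) : ℂ) * hexMidpoint z) *
            hexParafermionicObservable (Λ (ns n)) (e (ns n)) hexCriticalFugacity (5 / 8) z) /
        hexParafermionicObservable (Λ (ns n)) (e (ns n)) hexCriticalFugacity (5 / 8) (b (ns n)))
        atTop (𝓝 (l ψ))) →
    ∀ φ : ℂ → ℂ, ContDiff ℝ ∞ φ → HasCompactSupport φ → tsupport φ ⊆ D.carrier →
      l (dbarAlong 1 φ) = 0 := by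
  intro hCCN D ρ Λ m b hAF x e r mr hPR hx hL1 ns hns l hweak φ hφ hφc hφD
  obtain ⟨hρ, hflat1, hadm, hexh, hb⟩ := hAF
  obtain ⟨hr, hflatx, hroot, he⟩ := hPR
  set F : ℝ → Sym2 HexVertex → ℂ := fun δ z =>
    hexParafermionicObservable (Λ δ) (e δ) hexCriticalFugacity (5 / 8) z with hFdef
  ---------------------------------------------------------------- the compact `K` and its thickening
  set K : Set ℂ := tsupport φ with hKdef
  have hK : IsCompact K := hφc
  obtain ⟨ε₀, hε₀, hKε⟩ := hK.exists_cthickening_subset_open D.isOpen hφD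
  have hK' : IsCompact (Metric.cthickening ε₀ K) := hK.cthickening
  ---------------------------------------------------------------- the two derived test functions
  set ψ₁ : ℂ → ℂ := dbarAlong 1 φ with hψ₁
  set ψ₂ : ℂ → ℂ := fun z => (2 : ℂ)⁻¹ * (fderiv ℝ φ z 1 - I * fderiv ℝ φ z I) with hψ₂
  have hfdK : ∀ z, z ∉ K → fderiv ℝ φ z = 0 := fun z hz => by
    by_contra hne; exact hz (support_fderiv_subset ℝ (Function.mem_support.2 hne))
  have hψ₁K : ∀ z, z ∉ K → ψ₁ z = 0 := fun z hz => dbarAlong_eq_zero_of_notMem_tsupport hz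
  have hψ₂K : ∀ z, z ∉ K → ψ₂ z = 0 := fun z hz => by simp [hψ₂, hfdK z hz]
  have hψ₁c : Continuous ψ₁ := continuous_dbarAlong_one hφ
  have hψ₁cs : HasCompactSupport ψ₁ := HasCompactSupport.intro hK hψ₁K
  have hψ₁s : tsupport ψ₁ ⊆ D.carrier := (tsupport_subset_of_eq_zero hK.isClosed hψ₁K).trans hφD
  have hψ₂d : ContDiff ℝ 1 ψ₂ := contDiff_one_dAlong hφ
  have hψ₂cs : HasCompactSupport ψ₂ := HasCompactSupport.intro hK hψ₂K
  have hψ₂s : tsupport ψ₂ ⊆ D.carrier := (tsupport_subset_of_eq_zero hK.isClosed hψ₂K).trans hφD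
  ---------------------------------------------------------------- the three limits along `ns`
  -- (1) the weak limit at the continuous test `∂̄φ`
  have hN := hweak ψ₁ hψ₁c hψ₁cs hψ₁s
  -- (2) the conjugate-class sum at `∂φ`, through the re-marked domain
  obtain ⟨hxfr, -⟩ := mem_frontier_of_flat_piece D hr hflatx
  obtain ⟨D', hcar, h0, h1⟩ := exists_dobrushinDomain_pt_zero_eq D hxfr hx
  have hadm' : ∀ᶠ δ : ℝ in 𝓝[>] 0, hexDomainSimplyConnected (Λ δ) ∧
      e δ ∈ hexDomainBoundary (Λ δ) ∧ b δ ∈ hexDomainBoundary (Λ δ) ∧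
      Nonempty (HexMidEdgeSAW (Λ δ) (e δ) (b δ)) ∧
      (hexGraph.induce ((Λ δ : Finset HexVertex) : Set HexVertex)).Preconnected ∧
      (∀ v ∈ Λ δ, (δ : ℂ) * hexCenter v ∈ D'.carrier) ∧
      (∀ v : HexVertex, (δ : ℂ) * hexCenter v ∈ Metric.ball (D'.pt 1) ρ →
        (v ∈ Λ δ ↔ m δ ≤ v.1 1)) := by
    filter_upwards [hadm, hroot] with δ hδ hδ'
    rw [hcar, h1]
    exact ⟨hδ.1, hδ'.1, hδ.2.1, hδ'.2.1, hδ.2.2.1, hδ.2.2.2.1, hδ.2.2.2.2⟩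
  have hflat1' : D'.carrier ∩ Metric.ball (D'.pt 1) ρ =
      {z : ℂ | (D'.pt 1).im < z.im} ∩ Metric.ball (D'.pt 1) ρ := by rw [hcar, h1]; exact hflat1
  have hexh' : ∀ K : Set ℂ, IsCompact K → K ⊆ D'.carrier →
      ∀ᶠ δ : ℝ in 𝓝[>] 0, ∀ v : HexVertex, (δ : ℂ) * hexCenter v ∈ K → v ∈ Λ δ := by
    rw [hcar]; exact hexh
  have he' : Tendsto (fun δ : ℝ => (δ : ℂ) * hexMidpoint (e δ)) (𝓝[>] 0) (𝓝 (D'.pt 0)) := by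
    rw [h0]; exact he
  have hb' : Tendsto (fun δ : ℝ => (δ : ℂ) * hexMidpoint (b δ)) (𝓝[>] 0) (𝓝 (D'.pt 1)) := by
    rw [h1]; exact hb
  have hψ₂s' : tsupport ψ₂ ⊆ D'.carrier := by rw [hcar]; exact hψ₂s
  have hCC0 := hCCN D' ρ Λ m e b ψ₂ hρ hflat1' hadm' hexh' he' hb' hψ₂d hψ₂cs hψ₂s'
  have hCC : Tendsto (fun n => ((ns n : ℝ) : ℂ) ^ 2 *
      (∑ᶠ p ∈ {p : HexVertex × HexVertex | s(p.1, p.2) ∈ hexDomainMidEdges (Λ (ns n)) ∧ p.1.2 = 0},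
        ψ₂ (((ns n : ℝ) : ℂ) * hexMidpoint s(p.1, p.2)) * conj (hexCenter p.2 - hexCenter p.1) *
          F (ns n) s(p.1, p.2)) / F (ns n) (b (ns n))) atTop (𝓝 0) := hCC0.comp hns
  -- (3) the remainder: `O(ns n)` eventually
  have hφ2 : ContDiff ℝ 2 φ := hφ.of_le (by
    change ((2 : ℕ∞) : WithTop ℕ∞) ≤ ((⊤ : ℕ∞) : WithTop ℕ∞)
    exact WithTop.coe_le_coe.2 le_top)
  obtain ⟨C, hC0, hedge⟩ := pickEngine_edgeTaylor φ hφ2 hφc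
  obtain ⟨C₁, hC₁⟩ := hL1 (Metric.cthickening ε₀ K) hK' hKε
  have hev : ∀ᶠ δ : ℝ in 𝓝[>] 0,
      ‖(1 / 3 : ℂ) * ((δ : ℂ) ^ 2 * (∑ᶠ z ∈ hexDomainMidEdges (Λ δ),
          ψ₁ ((δ : ℂ) * hexMidpoint z) * F δ z) / F δ (b δ)) +
        3 * vecA ^ 3 * ((δ : ℂ) ^ 2 * (∑ᶠ p ∈ {p : HexVertex × HexVertex |
            s(p.1, p.2) ∈ hexDomainMidEdges (Λ δ) ∧ p.1.2 = 0},
          ψ₂ ((δ : ℂ) * hexMidpoint s(p.1, p.2)) * conj (hexCenter p.2 - hexCenter p.1) *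
            F δ s(p.1, p.2)) / F δ (b δ))‖ ≤ 2 * C * (max C₁ 0) * δ := by
    have hsmall : ∀ᶠ δ : ℝ in 𝓝[>] 0, δ < ε₀ := by
      have : Iio ε₀ ∈ 𝓝 (0 : ℝ) := Iio_mem_nhds hε₀
      exact mem_nhdsWithin_of_mem_nhds this
    have hpos : ∀ᶠ δ : ℝ in 𝓝[>] 0, 0 < δ := self_mem_nhdsWithin
    filter_upwards [hpos, hsmall, hadm, hroot, hexh _ hK' hKε, hC₁] with δ hδ hδε hδadm hδroot hδexh hδL1
    have hVR : SatisfiesVertexRelations (Λ δ) (F δ) :=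
      (lemma1_iff.1 DuminilCopinSmirnov2012_lemma1_holds) (Λ δ) hδadm.1 (e δ) hδroot.1
    have hbound := pickEngine_weakDbarBound (Λ δ) (F δ) (b δ) φ K C δ ε₀ hVR subset_rfl hC0 hδ
      hδε.le hδexh (fun v w hv hw => hedge δ (F δ) v w hv hw)
    refine hbound.trans ?_
    -- `δ² · mass / ‖F b‖ ≤ max C₁ 0`
    have hmass : δ ^ 2 * (∑ᶠ z ∈ {z : Sym2 HexVertex | z ∈ hexDomainMidEdges (Λ δ) ∧
        (δ : ℂ) * hexMidpoint z ∈ Metric.cthickening ε₀ K}, ‖F δ z‖) / ‖F δ (b δ)‖ ≤ max C₁ 0 := by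
      by_cases hFb : ‖F δ (b δ)‖ = 0
      · rw [hFb, div_zero]; exact le_max_right _ _
      · rw [div_le_iff₀ (lt_of_le_of_ne (norm_nonneg _) (Ne.symm hFb))]
        exact hδL1.trans (mul_le_mul_of_nonneg_right (le_max_left _ _) (norm_nonneg _))
    calc 2 * C * δ * (δ ^ 2 * (∑ᶠ z ∈ {z : Sym2 HexVertex | z ∈ hexDomainMidEdges (Λ δ) ∧
          (δ : ℂ) * hexMidpoint z ∈ Metric.cthickening ε₀ K}, ‖F δ z‖) / ‖F δ (b δ)‖)
        ≤ 2 * C * δ * max C₁ 0 := mul_le_mul_of_nonneg_left hmass (by positivity)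
      _ = 2 * C * max C₁ 0 * δ := by ring
  -- along `ns`: the combination tends to `0`
  set Q : ℕ → ℂ := fun n => (1 / 3 : ℂ) * (((ns n : ℝ) : ℂ) ^ 2 *
      (∑ᶠ z ∈ hexDomainMidEdges (Λ (ns n)), ψ₁ (((ns n : ℝ) : ℂ) * hexMidpoint z) * F (ns n) z) /
        F (ns n) (b (ns n))) +
    3 * vecA ^ 3 * (((ns n : ℝ) : ℂ) ^ 2 * (∑ᶠ p ∈ {p : HexVertex × HexVertex |
        s(p.1, p.2) ∈ hexDomainMidEdges (Λ (ns n)) ∧ p.1.2 = 0},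
      ψ₂ (((ns n : ℝ) : ℂ) * hexMidpoint s(p.1, p.2)) * conj (hexCenter p.2 - hexCenter p.1) *
        F (ns n) s(p.1, p.2)) / F (ns n) (b (ns n))) with hQ
  have hQ0 : Tendsto Q atTop (𝓝 0) := by
    rw [tendsto_zero_iff_norm_tendsto_zero]
    have hns0 : Tendsto ns atTop (𝓝 0) := hns.mono_right nhdsWithin_le_nhds
    have hmaj : Tendsto (fun n => 2 * C * max C₁ 0 * ns n) atTop (𝓝 0) := by
      simpa using hns0.const_mul (2 * C * max C₁ 0)
    refine squeeze_zero' (Eventually.of_forall fun n => norm_nonneg _) ?_ hmaj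
    exact hns.eventually hev
  -- and to `(1/3) l(∂̄φ) + 3a³ · 0`
  have hQ1 : Tendsto Q atTop (𝓝 ((1 / 3 : ℂ) * l ψ₁ + 3 * vecA ^ 3 * 0)) :=
    (hN.const_mul (1 / 3 : ℂ)).add (hCC.const_mul (3 * vecA ^ 3))
  have hlim := tendsto_nhds_unique hQ1 hQ0
  rw [mul_zero, add_zero, mul_eq_zero] at hlim
  rcases hlim with h3 | hI
  · norm_num at h3
  · exact hI


/-- **Holomorphic local representation of the weak limit (registered sub-goal
`pickEngine_holomorphicWeakLimit`, engine inputs (S1)+(S2) composed; single-ball form).**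
For an admissible family pinned at a flat root `x ≠ D.pt 1` (the skeleton's `AdmissibleFamily`,
`PinnedFlatRoot`, unfolded), the route's `ConjugateClassNegligible` and the local `L¹` law at the
root family: every mesh sequence `ns → 0⁺` has a subsequence `ns ∘ ms` along which the normalised
functionals `N` converge on every continuous compactly supported test `ψ` in the carrier to `L ψ`
(`weakStarLimit_of_localL1`: `L` linear on tests, `‖L ψ‖ ≤ C_K sup ‖ψ‖`); the limit KILLS `∂̄φ`
for smooth compactly supported `φ` (`weakDbar_functional`); and on every ball with
`closedBall z₀ (3R) ⊆ carrier` there is `g` HOLOMORPHIC on `ball z₀ (3R/2)` with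
`L φ = ∫ φ g` for every smooth `φ` supported in `ball z₀ R` (Weyl's lemma,
`Literature.Analysis.Complex.weyl_dbar_ball_functional`, applied to the representing functional
`Λb` on `ℂ →ᵇ ℂ`).  Still assumed downstream (not in this file): the passage from smooth to
continuous tests in a ball (mollification + the bound `C_K`) and the patching of the local `g`'s
into one holomorphic function on the carrier (uniqueness on overlaps + partition of unity). [folklore] -/
theorem holomorphicWeakLimit_ball :
    ConjugateClassNegligible →
    ∀ (D : DobrushinDomain) (ρ : ℝ) (Λ : ℝ → Finset HexVertex) (m : ℝ → ℤ)
      (b : ℝ → Sym2 HexVertex),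
    (0 < ρ ∧
      D.carrier ∩ Metric.ball (D.pt 1) ρ = {z : ℂ | (D.pt 1).im < z.im} ∩ Metric.ball (D.pt 1) ρ ∧
      (∀ᶠ δ : ℝ in 𝓝[>] 0, hexDomainSimplyConnected (Λ δ) ∧ b δ ∈ hexDomainBoundary (Λ δ) ∧
        (hexGraph.induce ((Λ δ : Finset HexVertex) : Set HexVertex)).Preconnected ∧
        (∀ v ∈ Λ δ, (δ : ℂ) * hexCenter v ∈ D.carrier) ∧
        (∀ v : HexVertex, (δ : ℂ) * hexCenter v ∈ Metric.ball (D.pt 1) ρ →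
          (v ∈ Λ δ ↔ m δ ≤ v.1 1))) ∧
      (∀ K : Set ℂ, IsCompact K → K ⊆ D.carrier →
        ∀ᶠ δ : ℝ in 𝓝[>] 0, ∀ v : HexVertex, (δ : ℂ) * hexCenter v ∈ K → v ∈ Λ δ) ∧
      Tendsto (fun δ : ℝ => (δ : ℂ) * hexMidpoint (b δ)) (𝓝[>] 0) (𝓝 (D.pt 1))) →
    ∀ (x : ℂ) (e : ℝ → Sym2 HexVertex) (r : ℝ) (mr : ℝ → ℤ),
    (0 < r ∧
      D.carrier ∩ Metric.ball x r = {z : ℂ | x.im < z.im} ∩ Metric.ball x r ∧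
      (∀ᶠ δ : ℝ in 𝓝[>] 0, e δ ∈ hexDomainBoundary (Λ δ) ∧
        Nonempty (HexMidEdgeSAW (Λ δ) (e δ) (b δ)) ∧
        (∀ v : HexVertex, (δ : ℂ) * hexCenter v ∈ Metric.ball x r → (v ∈ Λ δ ↔ mr δ ≤ v.1 1))) ∧
      Tendsto (fun δ : ℝ => (δ : ℂ) * hexMidpoint (e δ)) (𝓝[>] 0) (𝓝 x)) →
    x ≠ D.pt 1 →
    (∀ K : Set ℂ, IsCompact K → K ⊆ D.carrier → ∃ C : ℝ, ∀ᶠ δ : ℝ in 𝓝[>] 0,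
      δ ^ 2 * (∑ᶠ z ∈ {z : Sym2 HexVertex | z ∈ hexDomainMidEdges (Λ δ) ∧
          (δ : ℂ) * hexMidpoint z ∈ K},
        ‖hexParafermionicObservable (Λ δ) (e δ) hexCriticalFugacity (5 / 8) z‖) ≤
      C * ‖hexParafermionicObservable (Λ δ) (e δ) hexCriticalFugacity (5 / 8) (b δ)‖) →
    ∀ (ns : ℕ → ℝ), Tendsto ns atTop (𝓝[>] 0) →
    ∃ ms : ℕ → ℕ, StrictMono ms ∧ ∃ L : C(ℂ, ℂ) → ℂ,
      (∀ ψ : C(ℂ, ℂ), HasCompactSupport ψ → tsupport ψ ⊆ D.carrier →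
        Tendsto (fun n => ((ns (ms n) : ℝ) : ℂ) ^ 2 *
            (∑ᶠ z ∈ hexDomainMidEdges (Λ (ns (ms n))),
              ψ (((ns (ms n) : ℝ) : ℂ) * hexMidpoint z) *
                hexParafermionicObservable (Λ (ns (ms n))) (e (ns (ms n))) hexCriticalFugacity
                  (5 / 8) z) /
            hexParafermionicObservable (Λ (ns (ms n))) (e (ns (ms n))) hexCriticalFugacity (5 / 8)
              (b (ns (ms n)))) atTop (𝓝 (L ψ))) ∧
      (∀ ψ₁ ψ₂ : C(ℂ, ℂ), HasCompactSupport ψ₁ → tsupport ψ₁ ⊆ D.carrier → HasCompactSupport ψ₂ →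
        tsupport ψ₂ ⊆ D.carrier → L (ψ₁ + ψ₂) = L ψ₁ + L ψ₂) ∧
      (∀ (c : ℂ) (ψ : C(ℂ, ℂ)), HasCompactSupport ψ → tsupport ψ ⊆ D.carrier →
        L (c • ψ) = c * L ψ) ∧
      (∀ K : Set ℂ, IsCompact K → K ⊆ D.carrier → ∃ C : ℝ, 0 ≤ C ∧ ∀ ψ : C(ℂ, ℂ),
        tsupport ψ ⊆ K → ∀ M : ℝ, (∀ z, ‖ψ z‖ ≤ M) → ‖L ψ‖ ≤ C * M) ∧
      (∀ φ : ℂ → ℂ, ContDiff ℝ ∞ φ → HasCompactSupport φ → tsupport φ ⊆ D.carrier →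
        ∀ Φ : C(ℂ, ℂ), (⇑Φ = dbarAlong 1 φ) → L Φ = 0) ∧
      (∀ (z₀ : ℂ) (R : ℝ), 0 < R → Metric.closedBall z₀ (3 * R) ⊆ D.carrier →
        ∃ g : ℂ → ℂ, DifferentiableOn ℂ g (Metric.ball z₀ (3 * R / 2)) ∧
          ∀ φ : ℂ → ℂ, ContDiff ℝ ∞ φ → HasCompactSupport φ → tsupport φ ⊆ Metric.ball z₀ R →
            ∀ Φ : C(ℂ, ℂ), (⇑Φ = φ) → L Φ = ∫ z, φ z * g z) := by
  intro hCCN D ρ Λ m b hAF x e r mr hPR hx hL1 ns hns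
  ---------------------------------------------------------------- (S1): the weak-* limit `L`
  obtain ⟨ms, hms, L, hconv, hadd, hsmul, hbd, hrep⟩ :=
    weakStarLimit_of_localL1 Λ e b D.isOpen hL1 ns hns
  have hns' : Tendsto (ns ∘ ms) atTop (𝓝[>] 0) := hns.comp hms.tendsto_atTop
  ---------------------------------------------------------------- (S2): `L` kills `∂̄φ`
  -- the limit values as a function of raw test functions
  obtain ⟨l, hl⟩ : ∃ l : (ℂ → ℂ) → ℂ, l = fun ψ => if h : Continuous ψ then L ⟨ψ, h⟩ else 0 :=
    ⟨_, rfl⟩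
  have hweak : ∀ ψ : ℂ → ℂ, Continuous ψ → HasCompactSupport ψ → tsupport ψ ⊆ D.carrier →
      Tendsto (fun n => (((ns ∘ ms) n : ℝ) : ℂ) ^ 2 *
        (∑ᶠ z ∈ hexDomainMidEdges (Λ ((ns ∘ ms) n)), ψ ((((ns ∘ ms) n : ℝ) : ℂ) * hexMidpoint z) *
          hexParafermionicObservable (Λ ((ns ∘ ms) n)) (e ((ns ∘ ms) n)) hexCriticalFugacity
            (5 / 8) z) /
        hexParafermionicObservable (Λ ((ns ∘ ms) n)) (e ((ns ∘ ms) n)) hexCriticalFugacity (5 / 8)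
          (b ((ns ∘ ms) n))) atTop (𝓝 (l ψ)) := by
    intro ψ hψ hψc hψD
    have h := hconv ⟨ψ, hψ⟩ hψc hψD
    have hlψ : l ψ = L ⟨ψ, hψ⟩ := by rw [hl]; exact dif_pos hψ
    rw [hlψ]
    exact h
  have hdbar : ∀ φ : ℂ → ℂ, ContDiff ℝ ∞ φ → HasCompactSupport φ → tsupport φ ⊆ D.carrier →
      ∀ Φ : C(ℂ, ℂ), (⇑Φ = dbarAlong 1 φ) → L Φ = 0 := by
    intro φ hφ hφc hφD Φ hΦ
    have h0 := weakDbar_functional hCCN D ρ Λ m b hAF x e r mr hPR hx hL1 (ns ∘ ms) hns' l hweak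
      φ hφ hφc hφD
    have hcont : Continuous (dbarAlong 1 φ) := continuous_dbarAlong_one hφ
    have hlv : l (dbarAlong 1 φ) = L ⟨dbarAlong 1 φ, hcont⟩ := by rw [hl]; exact dif_pos hcont
    have hΦeq : Φ = ⟨dbarAlong 1 φ, hcont⟩ := ContinuousMap.ext fun z => by rw [hΦ]; rfl
    rw [hΦeq, ← hlv]
    exact h0
  ---------------------------------------------------------------- Weyl's lemma on balls
  refine ⟨ms, hms, L, hconv, hadd, hsmul, hbd, hdbar, fun z₀ R hR hsub => ?_⟩
  obtain ⟨Λb, hΛb⟩ := hrep (Metric.closedBall z₀ (3 * R)) (isCompact_closedBall z₀ (3 * R)) hsub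
  have hball : Metric.ball z₀ (3 * R) ⊆ D.carrier := Metric.ball_subset_closedBall.trans hsub
  have hyp : ∀ φ : ℂ → ℂ, ContDiff ℝ ∞ φ → HasCompactSupport φ →
      tsupport φ ⊆ Metric.ball z₀ (3 * R) → ∀ Φ : ℂ →ᵇ ℂ, (⇑Φ = dbarAlong 1 φ) → Λb Φ = 0 := by
    intro φ hφ hφc hφB Φ hΦ
    have hts : tsupport (Φ : ℂ → ℂ) ⊆ Metric.closedBall z₀ (3 * R) := by
      rw [hΦ]
      refine (closure_minimal ?_ (isClosed_tsupport φ)).trans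
        (hφB.trans Metric.ball_subset_closedBall)
      intro z hz
      by_contra hzφ
      exact hz (dbarAlong_eq_zero_of_notMem_tsupport hzφ)
    rw [hΛb Φ hts]
    exact hdbar φ hφ hφc (hφB.trans hball) Φ.toContinuousMap hΦ
  obtain ⟨g, hg, hgrep⟩ := weyl_dbar_ball_functional Λb hR hyp
  refine ⟨g, hg, fun φ hφ hφc hφB Φ hΦ => ?_⟩
  -- a bounded continuous representative of `φ`
  obtain ⟨Cφ, hCφ⟩ := hφ.continuous.bounded_above_of_compact_support hφc
  obtain ⟨Φb, hΦb⟩ : ∃ Φb : ℂ →ᵇ ℂ, (⇑Φb = φ) :=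
    ⟨BoundedContinuousFunction.ofNormedAddCommGroup φ hφ.continuous Cφ hCφ, rfl⟩
  have hts : tsupport (Φb : ℂ → ℂ) ⊆ Metric.closedBall z₀ (3 * R) := by
    rw [hΦb]
    exact hφB.trans (Metric.ball_subset_closedBall.trans (Metric.closedBall_subset_closedBall
      (by linarith)))
  have hΦeq : Φ = Φb.toContinuousMap := ContinuousMap.ext fun z => by
    rw [hΦ]; exact (congrFun hΦb z).symm
  rw [← hgrep φ hφ hφc hφB Φb hΦb, hΛb Φb hts, hΦeq]

/-- **Registered sub-goal `pickEngine_holomorphicWeakLimit`** (crux item stmt-CriticalPhenomena-14004,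
line `pick-half-plane`, stub `stub_pickEngine`, inputs (S1)+(S2) composed in single-ball form):
registry form (one `∀`-term) of `holomorphicWeakLimit_ball`. [folklore] -/
theorem pickEngine_holomorphicWeakLimit : ConjugateClassNegligible → ∀ (D : DobrushinDomain) (ρ : ℝ) (Λ : ℝ → Finset HexVertex) (m : ℝ → ℤ) (b : ℝ → Sym2 HexVertex), (0 < ρ ∧ D.carrier ∩ Metric.ball (D.pt 1) ρ = {z : ℂ | (D.pt 1).im < z.im} ∩ Metric.ball (D.pt 1) ρ ∧ (∀ᶠ δ : ℝ in 𝓝[>] 0, hexDomainSimplyConnected (Λ δ) ∧ b δ ∈ hexDomainBoundary (Λ δ) ∧ (hexGraph.induce ((Λ δ : Finset HexVertex) : Set HexVertex)).Preconnected ∧ (∀ v ∈ Λ δ, (δ : ℂ) * hexCenter v ∈ D.carrier) ∧ (∀ v : HexVertex, (δ : ℂ) * hexCenter v ∈ Metric.ball (D.pt 1) ρ → (v ∈ Λ δ ↔ m δ ≤ v.1 1))) ∧ (∀ K : Set ℂ, IsCompact K → K ⊆ D.carrier → ∀ᶠ δ : ℝ in 𝓝[>] 0, ∀ v : HexVertex,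 (δ : ℂ) * hexCenter v ∈ K → v ∈ Λ δ) ∧ Tendsto (fun δ : ℝ => (δ : ℂ) * hexMidpoint (b δ)) (𝓝[>] 0) (𝓝 (D.pt 1))) → ∀ (x : ℂ) (e : ℝ → Sym2 HexVertex) (r : ℝ) (mr : ℝ → ℤ), (0 < r ∧ D.carrier ∩ Metric.ball x r = {z : ℂ | x.im < z.im} ∩ Metric.ball x r ∧ (∀ᶠ δ : ℝ in 𝓝[>] 0, e δ ∈ hexDomainBoundary (Λ δ) ∧ Nonempty (HexMidEdgeSAW (Λ δ) (e δ) (b δ)) ∧ (∀ v : HexVertex, (δ : ℂ) * hexCenter v ∈ Metric.ball x r → (v ∈ Λ δ ↔ mr δ ≤ v.1 1))) ∧ Tendsto (fun δ : ℝ => (δ : ℂ) * hexMidpoint (e δ)) (𝓝[>] 0) (𝓝 x)) → x ≠ D.pt 1 → (∀ K : Set ℂ, IsCompact K → K ⊆ D.carrier → ∃ C : ℝ, ∀ᶠ δ : ℝ in 𝓝[>] 0, δ ^ 2 * (∑ᶠ z ∈ {z : Sym2 HexVertex | z ∈ hexDomainMidEdges (Λ δ) ∧ (δ : ℂ) * hexMidpoint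 z ∈ K}, ‖hexParafermionicObservable (Λ δ) (e δ) hexCriticalFugacity (5 / 8) z‖) ≤ C * ‖hexParafermionicObservable (Λ δ) (e δ) hexCriticalFugacity (5 / 8) (b δ)‖) → ∀ (ns : ℕ → ℝ), Tendsto ns atTop (𝓝[>] 0) → ∃ ms : ℕ → ℕ, StrictMono ms ∧ ∃ L : C(ℂ, ℂ) → ℂ, (∀ ψ : C(ℂ, ℂ), HasCompactSupport ψ → tsupport ψ ⊆ D.carrier → Tendsto (fun n => ((ns (ms n) : ℝ) : ℂ) ^ 2 * (∑ᶠ z ∈ hexDomainMidEdges (Λ (ns (ms n))), ψ (((ns (ms n) : ℝ) : ℂ) * hexMidpoint z) * hexParafermionicObservable (Λ (ns (ms n))) (e (ns (ms n))) hexCriticalFugacity (5 / 8) z) / hexParafermionicObservable (Λ (ns (ms n))) (e (ns (ms n))) hexCriticalFugacity (5 / 8) (b (ns (ms n)))) atTop (𝓝 (L ψ))) ∧ (∀ ψ₁ ψ₂ : C(ℂ, ℂ), HasCompactSupport ψ₁ → tsupport ψ₁ ⊆ D.carrier → HasCompactSupport ψ₂ → tsupport ψ₂ ⊆ D.carrier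 → L (ψ₁ + ψ₂) = L ψ₁ + L ψ₂) ∧ (∀ (c : ℂ) (ψ : C(ℂ, ℂ)), HasCompactSupport ψ → tsupport ψ ⊆ D.carrier → L (c • ψ) = c * L ψ) ∧ (∀ K : Set ℂ, IsCompact K → K ⊆ D.carrier → ∃ C : ℝ, 0 ≤ C ∧ ∀ ψ : C(ℂ, ℂ), tsupport ψ ⊆ K → ∀ M : ℝ, (∀ z, ‖ψ z‖ ≤ M) → ‖L ψ‖ ≤ C * M) ∧ (∀ φ : ℂ → ℂ, ContDiff ℝ ∞ φ → HasCompactSupport φ → tsupport φ ⊆ D.carrier → ∀ Φ : C(ℂ, ℂ), (⇑Φ = dbarAlong 1 φ) → L Φ = 0) ∧ (∀ (z₀ : ℂ) (R : ℝ), 0 < R → Metric.closedBall z₀ (3 * R) ⊆ D.carrier → ∃ g : ℂ → ℂ, DifferentiableOn ℂ g (Metric.ball z₀ (3 * R / 2)) ∧ ∀ φ : ℂ → ℂ, ContDiff ℝ ∞ φ → HasCompactSupport φ → tsupport φ ⊆ Metric.ball z₀ R → ∀ Φ : C(ℂ, ℂ), (⇑Φ = φ) → L Φ = ∫ z, φ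 z * g z) :=
  holomorphicWeakLimit_ball

end Summit.CriticalPhenomena.SAWScalingLimit.Theorems.PickHalfPlane.LocalL1

end
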